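import Literature.AlgebraicGeometry.HodgeTheory.PicardLefschetzExchangedPairCore
import Literature.AlgebraicGeometry.HodgeTheory.PicardLefschetzExchangedPairPlane
import Literature.AlgebraicGeometry.HodgeTheory.TwoNodalFormBranchesSymmetric
import Literature.AlgebraicGeometry.HodgeTheory.ExchangedNodesDiagonalSymmetry
import Literature.AlgebraicGeometry.HodgeTheory.UniversalHypersurfaceTwistedLoopTransport
import Literature.AlgebraicGeometry.HodgeTheory.NodalPencilPicardLefschetz
import Literature.AlgebraicTopology.FundamentalGroup.TwoTransversalBranchesLoops
import HarnessLib

/-!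
# hPL₂exch from hPL₁: Picard–Lefschetz data for an EXCHANGED PAIR of nodes from the one-node theorem
# (programme «PL2-MERIDIANS», final assembly)

Family `hodge`, layer `Literature/AlgebraicGeometry/HodgeTheory`. Theorems only. Written by the prover seat
`hodge-nonav-20241-p1` (g18, cell `hodge-nonav`) for crux K1-B `VeryGeneralSignCommutatorsInHg` of route
`HodgeConjecture/SignSymmetricPowers` (stmt-HodgeConjecture-19716), registry binder hPL₂exch =
`picardLefschetz_exchangedPair` (`PicardLefschetzNodalFormsKeyed` :93).

THE CHAIN. `f₁` has exactly two nodes `[p₀], [p₁]`, exchanged by a diagonal `a` stabilising `f₁` and the pencil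
direction `g` (`g(pᵢ) ≠ 0`). Choose an `a`-eigenmonomial `h = x^m` separating the nodes
(`exists_eigenMonomial_separating`; `h(a•x) = χ h(x)`, `χ ≠ 1`); in the unfolding `F_{u,v} = f₁ + u g + v h` the
discriminant near `0` is two smooth transversal branches, swapped by `ι(u,v) = (u, χ⁻¹v)`, and members on ONE
branch are one-nodal (`exists_twoNodal_branches_symm`); hence the pencil circle `γ : θ ↦ f₁ + εe^{2πiθ}g`
decomposes in `π₁` of the nonsingular locus as `[γ] = [ℓ₀]·[ι∘ℓ₀] = [ι∘ℓ₀]·[ℓ₀]` for a lasso `ℓ₀ = α₀·μ₀·α₀⁻¹`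
around a one-nodal member of branch `0` in direction `g` (`TwoTransversalBranches.pencilCircle_eq_trans_iota`,
littype-FH1-2); the one-node theorem hPL₁ gives Picard–Lefschetz data for `μ₀` (its even-dimensional rider follows
from that of `γ`), the leash carries them to the base point (`IsPicardLefschetzData.exists_of_leash`), the monodromy
of `ι∘ℓ₀` is the `σ′^*`-conjugate of that of `ℓ₀` with `σ′ : [z] ↦ [a • z]`
(`DiagonalTorus.exists_fiberIso_isRatTransport_twistedLoop_isometry`, prover-Bx; `σ′^*` is a monodromy, hence an
isometry of `tr ∘ ∪`), and the core
`exists_isPicardLefschetzData_two_of_meridian` (commuting one-cycle transformations have orthogonal cycles)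
yields `IsPicardLefschetzData n d 2 … γ ![δ₀, δ₁] c` with `σ′^*δ₀ = δ₁`.

* `picardLefschetz_exchangedPair_of_supplier` — the master theorem: hPL₂exch's conclusion for `(f₁, g, p, a)`
  from a one-node supplier for the direction `g` (the body of hPL₁ specialised to `g`);
* `picardLefschetz_exchangedPair_of_oneNode : picardLefschetz_oneNode → picardLefschetz_exchangedPair`;
* `picardLefschetz_exchangedPair_monomial` — UNCONDITIONAL for monomial directions `g = a′ • xᵢ^d`
  (supplier = prover-Bx's theorem `NodalPencil.picardLefschetz_oneNode_monomial`).

Honest scope: Picard–Lefschetz package of route B; nothing here says HC is proved; rung F-H1 not moved.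

## References

* [VoisinHodgeII2003] C. Voisin, Hodge Theory and Complex Algebraic Geometry II, CUP 2003, §2.3.1–2.3.2,
  §3.2.1 Thm. 3.16, Cor. 3.17, Rem. 3.21, §3.1.2.
* [ArnoldGuseinzadeVarchenko2012] AGZV II, Part I §1.3, §2.1, §5.2.
* [Lamotke1981] K. Lamotke, The topology of complex projective varieties after S. Lefschetz, §6.
-/

noncomputable section

open CategoryTheory AlgebraicGeometry MvPolynomial
open _root_.Topology _root_.Filter
open scoped unitInterval
open Literature.AlgebraicTopology.SingularHomology
open Literature.AlgebraicGeometry.Motives Literature.AlgebraicGeometry.Motives.UniversalHypersurface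
open Literature.AlgebraicGeometry.HodgeTheory.UniversalHypersurface
open Literature.AlgebraicGeometry.HodgeTheory.BettiUniverse
open Literature.AlgebraicTopology.FundamentalGroup
open Literature.AlgebraicGeometry.HodgeTheory.ExchangedPairPlane

namespace Literature.AlgebraicGeometry.HodgeTheory

variable {n d : ℕ}

/-! ### §3 The master theorem: hPL₂exch for `(f₁, g, p, a)` from a one-node supplier for the direction `g` -/

/-- **hPL₂exch from a one-node supplier** (module docstring: eigen-monomial unfolding, two transversal branches
swapped by `ι`, decomposition of the pencil circle into two commuting one-node meridians, leash, `σ′`-conjugation,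
core). The supplier `hPLg` is the body of `picardLefschetz_oneNode` for the fixed direction `g`.
[cite: VoisinHodgeII2003, §3.2.1 Thm. 3.16, Cor. 3.17, Rem. 3.21, §2.3.1–2.3.2 and §3.1.2]
[cite: ArnoldGuseinzadeVarchenko2012, Part I §1.3, §2.1 and §5.2] [cite: Lamotke1981, §6] -/
theorem picardLefschetz_exchangedPair_of_supplier (n d : ℕ) (hn : 1 ≤ n) (hd : 1 ≤ d)
    (f₁ g : MvPolynomial (Fin (n + 2)) ℂ) (hf₁ : f₁.IsHomogeneous d) (hg : g.IsHomogeneous d)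
    (hPLg : ∀ (F : MvPolynomial (Fin (n + 2)) ℂ), F.IsHomogeneous d → ∀ z : Fin (n + 2) → ℂ,
      IsNodalFormWithNodes F ![z] → eval z g ≠ 0 →
      ∃ ε₀ : ℝ, 0 < ε₀ ∧
        (∀ c' : ℂ, c' ≠ 0 → ‖c'‖ < ε₀ → SmoothHypersurface.IsNonsingularForm ℂ (F + c' • g)) ∧
        ∀ (hU : IsCohomologicallyLocallyTrivialOn (family ℂ n d) Set.univ) (ε : ℝ), 0 < ε → ε < ε₀ →
          ∀ (s' : ComplexPoints (base ℂ n d)), pointForm ℂ n d s' = F + (ε : ℂ) • g →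
            ∀ (γ : Path s' s'), IsPencilCircle n d F g ε γ →
              (Even n → ∀ T : bettiCohomology (fiberOver (family ℂ n d) s') n ≃ₗ[ℚ]
                  bettiCohomology (fiberOver (family ℂ n d) s') n,
                IsRatTransport (family ℂ n d) n hU (loopClassUniv n d γ) T → T ≠ LinearEquiv.refl ℚ _) →
              ∃ (δ : bettiCohomology (fiberOver (family ℂ n d) s') n) (c : ℚ),
                IsPicardLefschetzData n d 1 hn hd hU γ ![δ] c)
    (p : Fin 2 → Fin (n + 2) → ℂ) (hnod : IsNodalFormWithNodes f₁ p) (hgp : ∀ i, eval (p i) g ≠ 0)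
    (a : Fin (n + 2) → ℂˣ) (ha₁ : a ∈ diagonalStabilizer f₁) (hag : a ∈ diagonalStabilizer g)
    (h10 : ∃ t : ℂ, a • p 1 = t • p 0) :
    ∃ ε₀ : ℝ, 0 < ε₀ ∧
      (∀ c' : ℂ, c' ≠ 0 → ‖c'‖ < ε₀ → SmoothHypersurface.IsNonsingularForm ℂ (f₁ + c' • g)) ∧
      ∀ (hU : IsCohomologicallyLocallyTrivialOn (family ℂ n d) Set.univ) (ε : ℝ), 0 < ε → ε < ε₀ →
        ∀ (s' : ComplexPoints (base ℂ n d)), pointForm ℂ n d s' = f₁ + (ε : ℂ) • g →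
          ∀ (γ : Path s' s'), IsPencilCircle n d f₁ g ε γ →
            (Even n → ∀ T : bettiCohomology (fiberOver (family ℂ n d) s') n ≃ₗ[ℚ]
                bettiCohomology (fiberOver (family ℂ n d) s') n,
              IsRatTransport (family ℂ n d) n hU (loopClassUniv n d γ) T → T ≠ LinearEquiv.refl ℚ _) →
            ∃ (δ : Fin 2 → bettiCohomology (fiberOver (family ℂ n d) s') n) (c : ℚ),
              IsPicardLefschetzData n d 2 hn hd hU γ δ c ∧
                ∀ (σ' : fiberOver (family ℂ n d) s' ⟶ fiberOver (family ℂ n d) s'),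
                  (∀ x : ComplexPoints (fiberOver (family ℂ n d) s'),
                      fibrePoint n d s' (AlgPoints.map σ' x) =
                        Projectivization.mk ℂ (a • (fibrePoint n d s' x).rep)
                          ((smul_ne_zero_iff_ne a).mpr (Projectivization.rep_nonzero _))) →
                  BettiUniverse.pull σ' n (δ 0) = δ 1 ∨ BettiUniverse.pull σ' n (δ 0) = -δ 1 := by
  classical
  -- nodes, the second exchange relation, an eigen-monomial `h` separating the nodes
  have hp0 : p 0 ≠ 0 := (hnod.1 0).ne_zero
  have hne01 : ∀ t : ℂ, p 1 ≠ t • p 0 := fun t ht => absurd (hnod.2.1 1 0 ⟨t, ht⟩) (by decide)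
  obtain ⟨t₁₀, ht₁₀⟩ := h10
  have ht₁₀0 : t₁₀ ≠ 0 := by
    intro h0; rw [h0, zero_smul] at ht₁₀
    exact (hnod.1 1).ne_zero (by have := congrArg (fun x => a⁻¹ • x) ht₁₀; simpa using this)
  have h01 : ∃ t : ℂ, a • p 0 = t • p 1 := hnod.exists_smul_eq_swap ha₁ ⟨t₁₀, ht₁₀⟩
  obtain ⟨m, hmdeg, hm0, hm1⟩ := exists_eigenMonomial_separating (a := a) hd hp0 hne01 ⟨t₁₀, ht₁₀⟩
  set h : MvPolynomial (Fin (n + 2)) ℂ := monomial m 1 with hh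
  set χ : ℂ := ∏ i, ((a i : ℂˣ) : ℂ) ^ m i with hχdef
  have hhd : h.IsHomogeneous d := by rw [hh]; exact isHomogeneous_monomial _ hmdeg
  have hχ : aeval (diagonalSubst a) h = χ • h := by rw [hh, hχdef]; exact aeval_diagonalSubst_monomial_one a m
  have hχ0 : χ ≠ 0 := by
    rw [hχdef]; exact Finset.prod_ne_zero_iff.2 fun i _ => pow_ne_zero _ (Units.ne_zero _)
  have hχ1 : χ ≠ 1 := hm1
  have heval_h : ∀ x : Fin (n + 2) → ℂ, eval x h = ∏ i, x i ^ m i := fun x => by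
    rw [hh, eval_monomial, one_mul, Finsupp.prod_fintype m (fun i r => x i ^ r) (fun _ => pow_zero _)]
  have hh0 : eval (p 0) h ≠ 0 := by rw [heval_h]; exact hm0
  -- the unfolding: branch functions, swap, one-nodal members
  obtain ⟨φ, z, N, hNo, h0N, hφ0, hφd, -, hz, hΩN, hone, hsw⟩ :=
    DiscriminantBranches.exists_twoNodal_branches_symm hf₁ hg hhd hnod hgp ha₁ hag hχ hχ0 ⟨t₁₀, ht₁₀⟩ h01
  -- the nonsingular locus of the plane and its classifying map
  set Ω : Set (ℂ × ℂ) := {q : ℂ × ℂ | SmoothHypersurface.IsNonsingularForm ℂ (f₁ + q.1 • g + q.2 • h)} with hΩdef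
  obtain ⟨P, hP⟩ := exists_planeMap (n := n) hf₁ hg hhd
  have hΩ : ∀ q ∈ N, q ∈ Ω ↔ φ 0 q ≠ 0 ∧ φ 1 q ≠ 0 := fun q hq => hΩN q hq
  -- transversality data for the topology brick
  have hD10 : ∀ i, (eval (p i) g • ContinuousLinearMap.fst ℂ ℂ ℂ + eval (p i) h • ContinuousLinearMap.snd ℂ ℂ ℂ)
      (1, 0) = eval (p i) g := fun i => by
    show eval (p i) g * 1 + eval (p i) h * 0 = eval (p i) g; ring
  have hD01 : ∀ i, (eval (p i) g • ContinuousLinearMap.fst ℂ ℂ ℂ + eval (p i) h • ContinuousLinearMap.snd ℂ ℂ ℂ)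
      (0, 1) = eval (p i) h := fun i => by
    show eval (p i) g * 0 + eval (p i) h * 1 = eval (p i) h; ring
  have hdet : eval (p 0) g * eval (p 1) h ≠ eval (p 0) h * eval (p 1) g :=
    transversal_of_eigenform (p := p) hag hχ hχ1 hχ0 hg hhd (hgp 0) hh0 ht₁₀ ht₁₀0
  -- the symmetry on the plane: `ι'(u,v) = (u, χ v)` (then `F_{ι' q} = F_q ∘ (a • ·)`), and its swap clauses
  set ι : ℂ × ℂ → ℂ × ℂ := fun q => (q.1, χ * q.2) with hιdef
  have hιc : Continuous ι := Continuous.prodMk continuous_fst (continuous_const.mul continuous_snd)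
  have hιu : ∀ (q : ℂ × ℂ) (c : ℂ), ι (q + (c, 0)) = ι q + (c, 0) := fun q c => by
    ext <;> simp [hιdef]
  have hι0 : ∀ u : ℂ, ι (u, 0) = (u, 0) := fun u => by simp [hιdef]
  have hιι : ∀ q : ℂ × ℂ, ((ι q).1, χ⁻¹ * (ι q).2) = q := fun q => by
    ext <;> simp [hιdef, ← mul_assoc, inv_mul_cancel₀ hχ0]
  set N' : Set (ℂ × ℂ) := N ∩ ι ⁻¹' N with hN'def
  have hN'o : IsOpen N' := hNo.inter (hNo.preimage hιc)
  have h0N' : (0 : ℂ × ℂ) ∈ N' := ⟨h0N, by show ι 0 ∈ N; rw [show ι 0 = 0 by simp [hιdef]]; exact h0N⟩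
  have hΩ' : ∀ q ∈ N', q ∈ Ω ↔ φ 0 q ≠ 0 ∧ φ 1 q ≠ 0 := fun q hq => hΩ q hq.1
  have hsw' : ∀ q ∈ N', (φ 1 (ι q) = 0 ↔ φ 0 q = 0) ∧ (φ 0 (ι q) = 0 ↔ φ 1 q = 0) := by
    intro q hq
    have h := hsw (ι q) hq.2
    rw [hιι q] at h
    exact ⟨h.2.symm, h.1.symm⟩
  -- the topology brick, symmetric form
  obtain ⟨N₁, N₂, -, hN₂o, h0N₂, hN₂₁, hN₁N, -, hιΩ, -, hpc₂, -, ε₀L, hε₀L, hL⟩ :=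
    TwoTransversalBranches.pencilCircle_eq_trans_iota (Ω := Ω) (hφd 0) (hφd 1) (hφ0 0) (hφ0 1)
      (by rw [hD10]; exact hgp 0) (by rw [hD10]; exact hgp 1)
      (by rw [hD10, hD10, hD01, hD01]; exact hdet) (hN'o.mem_nhds h0N') hΩ' hιc hιu hι0 hsw'
  -- the nonsingularity radius of the pencil `f₁ + c g`
  obtain ⟨ε₀S, hε₀S, hS⟩ := hnod.exists_isNonsingularForm_add_smul hd hf₁ hg hgp
  refine ⟨min ε₀S ε₀L, lt_min hε₀S hε₀L, fun c' hc' hlt => hS c' hc' (hlt.trans_le (min_le_left _ _)), ?_⟩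
  intro hU ε hε hεlt s' hs' γ hγ hrider
  have hεL : ε < ε₀L := hεlt.trans_le (min_le_right _ _)
  obtain ⟨hcircle, hF⟩ := hL ε hε hεL
  -- a branch-0-only point in `N₂`, its one-nodal member, the supplier there
  obtain ⟨F₀, hF₀N₂, hF₀0, hF₀1⟩ := TwoTransversalBranches.exists_mem_branch_zero (hφd 0) (hφd 1) (hφ0 0) (hφ0 1)
    (by rw [hD10]; exact hgp 0) (by rw [hD10]; exact hgp 1) (by rw [hD10, hD10, hD01, hD01]; exact hdet)
    (hN₂o.mem_nhds h0N₂)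
  obtain ⟨ρbar, hρbar, hρ⟩ := hF F₀ hF₀N₂ hF₀0 hF₀1
  have hF₀N : F₀ ∈ N := (hN₁N (hN₂₁ hF₀N₂)).1
  obtain ⟨hnod₀, hgz₀⟩ := hone F₀ hF₀N 0 hF₀0 (fun i' hi' => by
    fin_cases i'
    · exact absurd rfl hi'
    · exact hF₀1)
  set F : MvPolynomial (Fin (n + 2)) ℂ := f₁ + F₀.1 • g + F₀.2 • h with hFdef
  have hFhom : F.IsHomogeneous d := isHomogeneous_add_smul (isHomogeneous_add_smul hf₁ hg _) hhd _
  obtain ⟨ε₀', hε₀', -, hPL₀⟩ := hPLg F hFhom (z 0 F₀) hnod₀ hgz₀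
  set ρ₀ : ℝ := min ρbar (ε₀' / 2) with hρ₀def
  have hρ₀pos : 0 < ρ₀ := lt_min hρbar (by linarith)
  have hρ₀bar : ρ₀ ≤ ρbar := min_le_left _ _
  have hρ₀ε : ρ₀ < ε₀' := (min_le_right _ _).trans_lt (by linarith)
  obtain ⟨hdisc₀, hdisc₁, hmain⟩ := hρ ρ₀ hρ₀pos hρ₀bar
  -- norms of the circle points
  have hnexp : ∀ (r : ℝ) (θ : ℝ), 0 < r →
      ‖(r : ℂ) * Complex.exp (2 * Real.pi * Complex.I * (θ : ℂ))‖ = r := fun r θ hr => by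
    rw [norm_mul, Complex.norm_real, Real.norm_eq_abs, abs_of_pos hr,
      show (2 * Real.pi * Complex.I * (θ : ℂ)) = ((2 * Real.pi * θ : ℝ) : ℂ) * Complex.I by push_cast; ring,
      Complex.norm_exp_ofReal_mul_I, mul_one]
  have hne_exp : ∀ (r : ℝ) (θ : ℝ), 0 < r → (r : ℂ) * Complex.exp (2 * Real.pi * Complex.I * (θ : ℂ)) ≠ 0 :=
    fun r θ hr => mul_ne_zero (by exact_mod_cast hr.ne') (Complex.exp_ne_zero _)
  -- the loops in the plane: the pencil circle `γp` at `x`, the meridian `μ₀` at `y₀`, a leash `α₀` in `N₂`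
  obtain ⟨x, γp, hx, hγp⟩ := exists_circlePath (Ω := Ω) 0 ε (fun θ => by
    have := (hcircle θ).1; simpa using this)
  have hxval : (x : ℂ × ℂ) = ((ε : ℂ), 0) := by rw [hx]; simp
  obtain ⟨y₀, μ₀, hy₀, hμ₀⟩ := exists_circlePath (Ω := Ω) F₀ ρ₀ (fun θ =>
    (hdisc₀ _ (hne_exp ρ₀ θ hρ₀pos) (le_of_eq (hnexp ρ₀ θ hρ₀pos))).1)
  have hxΩN₂ : (x : ℂ × ℂ) ∈ Ω ∩ N₂ := by
    have := hcircle 0; rw [hxval]; simpa using this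
  have hy₀ΩN₂ : (y₀ : ℂ × ℂ) ∈ Ω ∩ N₂ := by
    rw [hy₀]
    exact hdisc₀ _ (by exact_mod_cast hρ₀pos.ne') (by rw [Complex.norm_real, Real.norm_eq_abs, abs_of_pos hρ₀pos])
  have hjoin := hpc₂.joinedIn _ hxΩN₂ _ hy₀ΩN₂
  obtain ⟨α₀', hα₀'⟩ := exists_subtypePath (Ω := Ω) hjoin.somePath (fun t => (hjoin.somePath_mem t).1)
  set α₀ : Path x y₀ := α₀'.cast (Subtype.ext rfl) (Subtype.ext rfl) with hα₀def
  have hα₀N₂ : ∀ t, (α₀ t : ℂ × ℂ) ∈ N₂ := fun t => by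
    show ((α₀' t : ↥Ω) : ℂ × ℂ) ∈ N₂
    rw [hα₀' t]; exact (hjoin.somePath_mem t).2
  -- the `ι`-images `μ₁ = ι ∘ μ₀`, `α₁ = ι ∘ α₀`
  have hιμ₀ : ∀ t, ι (μ₀ t : ℂ × ℂ) ∈ Ω := fun t => by
    rw [hμ₀ t, hιu]
    exact (hdisc₁ _ (hne_exp ρ₀ _ hρ₀pos) (le_of_eq (hnexp ρ₀ _ hρ₀pos))).1
  have hια₀ : ∀ t, ι (α₀ t : ℂ × ℂ) ∈ Ω := fun t => (hιΩ _ ⟨(α₀ t).2, hα₀N₂ t⟩).1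
  obtain ⟨μ₁, hμ₁⟩ := exists_imagePath hιc μ₀ hιμ₀
  obtain ⟨α₁', hα₁'⟩ := exists_imagePath hιc α₀ hια₀
  have hιx : ι (x : ℂ × ℂ) = x := by rw [hxval, hι0]
  have hxeq : x = ⟨ι (x : ℂ × ℂ), by simpa using hια₀ 0⟩ := Subtype.ext hιx.symm
  set α₁ : Path x ⟨ι (y₀ : ℂ × ℂ), by simpa using hια₀ 1⟩ := α₁'.cast hxeq rfl with hα₁def
  have hα₁ : ∀ t, (α₁ t : ℂ × ℂ) = ι (α₀ t) := fun t => hα₁' t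
  -- the decomposition of the pencil circle in `π₁(Ω, x)`, both orders
  have hγp' : ∀ θ : I, (γp θ : ℂ × ℂ) =
      ((ε : ℂ) * Complex.exp (2 * Real.pi * Complex.I * ((θ : ℝ) : ℂ)), 0) := fun θ => by
    rw [hγp θ, zero_add]
  obtain ⟨hdec₁, hdec₂⟩ := hmain x γp hγp' y₀ μ₀ hμ₀ α₀ hα₀N₂ _ μ₁ hμ₁ α₁ hα₁
  -- push forward to `U(ℂ)` (read in `univ`)
  set P' : C(↥Ω, ↥(Set.univ : Set (ComplexPoints (base ℂ n d)))) := (toUniv n d).comp P with hP'def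
  have hpush₁ := TwoTransversalBranches.map_mk_eq_lasso_trans P' hdec₁
  have hpush₂ := TwoTransversalBranches.map_mk_eq_lasso_trans P' hdec₂
  -- the base point `P x` is `s'`
  have hPx : P x = s' := pointForm_injective ℂ n d (by rw [hP, hxval, hs']; simp)
  subst hPx
  -- the base loops
  set μ₀b : Path (P y₀) (P y₀) := μ₀.map P.continuous with hμ₀b
  set α₀b : Path (P x) (P y₀) := α₀.map P.continuous with hα₀b
  set ℓ₁b : Path (P x) (P x) := ((α₁.map P.continuous).trans (μ₁.map P.continuous)).trans (α₁.map P.continuous).symm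
    with hℓ₁b
  have hmapP : ∀ {u v : ↥Ω} (q : Path u v), (q.map P.continuous).map (toUniv n d).continuous = q.map P'.continuous :=
    fun q => by rw [Path.map_map]; rfl
  have hℓ₀class : loopClassUniv n d ((α₀b.trans μ₀b).trans α₀b.symm) =
      Path.Homotopic.Quotient.mk (((α₀.map P'.continuous).trans (μ₀.map P'.continuous)).trans
        (α₀.map P'.continuous).symm) := by
    rw [loopClassUniv, hα₀b, hμ₀b, Path.map_trans, Path.map_trans, ← Path.map_symm, hmapP, hmapP]; rfl
  have hℓ₁class : loopClassUniv n d ℓ₁b =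
      Path.Homotopic.Quotient.mk (((α₁.map P'.continuous).trans (μ₁.map P'.continuous)).trans
        (α₁.map P'.continuous).symm) := by
    rw [loopClassUniv, hℓ₁b, Path.map_trans, Path.map_trans, ← Path.map_symm, hmapP, hmapP]; rfl
  have hγclass : loopClassUniv n d γ = Path.Homotopic.Quotient.mk (γp.map P'.continuous) := by
    have hpath : γ.map (toUniv n d).continuous = γp.map P'.continuous := by
      refine Path.ext (funext fun t => Subtype.ext ?_)
      change γ t = P (γp t)
      apply pointForm_injective ℂ n d
      rw [hγ t, hP, hγp' t]; simp
    rw [loopClassUniv, hpath]; rfl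
  have hγ₁ : loopClassUniv n d γ = (loopClassUniv n d ((α₀b.trans μ₀b).trans α₀b.symm)).trans (loopClassUniv n d ℓ₁b) := by
    rw [hγclass, hℓ₀class, hℓ₁class]; exact hpush₁
  have hγ₂ : loopClassUniv n d γ = (loopClassUniv n d ℓ₁b).trans (loopClassUniv n d ((α₀b.trans μ₀b).trans α₀b.symm)) := by
    rw [hγclass, hℓ₀class, hℓ₁class]; exact hpush₂
  have hcomm : (loopClassUniv n d ((α₀b.trans μ₀b).trans α₀b.symm)).trans (loopClassUniv n d ℓ₁b) =
      (loopClassUniv n d ℓ₁b).trans (loopClassUniv n d ((α₀b.trans μ₀b).trans α₀b.symm)) :=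
    hγ₁.symm.trans hγ₂
  -- the forms along the two lassos: `F_{ι q} = F_q ∘ (a • ·)`
  have haF : ∀ q : ℂ × ℂ, aeval (diagonalSubst a) (f₁ + q.1 • g + q.2 • h) = f₁ + (ι q).1 • g + (ι q).2 • h := by
    intro q
    rw [map_add, map_add, map_smul, map_smul, mem_diagonalStabilizer_iff.mp ha₁, mem_diagonalStabilizer_iff.mp hag,
      hχ, smul_smul]
    simp only [hιdef, mul_comm χ]
  have hvals : ∀ u, ((((α₁.trans μ₁).trans α₁.symm) u : ↥Ω) : ℂ × ℂ) = ι (((α₀.trans μ₀).trans α₀.symm) u) := by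
    intro u
    simp only [Path.trans_apply, Path.symm_apply]
    split_ifs <;> first | exact hα₁ _ | exact hμ₁ _
  have hℓ' : ∀ u, pointForm ℂ n d (ℓ₁b u) = aeval (diagonalSubst a) (pointForm ℂ n d (((α₀b.trans μ₀b).trans α₀b.symm) u)) := by
    intro u
    have h1 : ℓ₁b u = P (((α₁.trans μ₁).trans α₁.symm) u) := by
      rw [hℓ₁b]; simp only [Path.trans_apply, Path.symm_apply, Path.map_coe, Function.comp_apply]
      split_ifs <;> rfl
    have h0 : ((α₀b.trans μ₀b).trans α₀b.symm) u = P (((α₀.trans μ₀).trans α₀.symm) u) := by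
      rw [hα₀b, hμ₀b]; simp only [Path.trans_apply, Path.symm_apply, Path.map_coe, Function.comp_apply]
      split_ifs <;> rfl
    rw [h1, h0, hP, hP, haF, hvals]
  -- `a` stabilises the base form `f₁ + ε g`
  have hax : a ∈ diagonalStabilizer (pointForm ℂ n d (P x)) := by
    rw [mem_diagonalStabilizer_iff, hP, hxval]
    simp only [zero_smul, add_zero]
    rw [map_add, map_smul, mem_diagonalStabilizer_iff.mp ha₁, mem_diagonalStabilizer_iff.mp hag]
  -- the diagonal automorphism `σ'` of the fibre, the conjugation of transports along twisted loops in every degree,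
  -- and the isometry of `R = ((σ')^*)⁻¹` (prover-Bx, `UniversalHypersurfaceTwistedLoopTransport`)
  obtain ⟨σ', hσ'coord, -, -, hRiso, hσ'T⟩ :=
    DiagonalTorus.exists_fiberIso_isRatTransport_twistedLoop_isometry hn hd hU (P x) hax
  set R : bettiCohomology (fiberOver (family ℂ n d) (P x)) n ≃ₗ[ℚ] bettiCohomology (fiberOver (family ℂ n d) (P x)) n :=
    (BettiUniverse.pullEquiv σ' n).symm with hRdef
  have hℓ₁T : ∀ T : bettiCohomology (fiberOver (family ℂ n d) (P x)) n ≃ₗ[ℚ] bettiCohomology (fiberOver (family ℂ n d) (P x)) n,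
      IsRatTransport (family ℂ n d) n hU (loopClassUniv n d ((α₀b.trans μ₀b).trans α₀b.symm)) T →
        IsRatTransport (family ℂ n d) n hU (loopClassUniv n d ℓ₁b) (R.symm.trans (T.trans R)) := by
    intro T hT
    have h := (hσ'T n _ _ hℓ').1 hT
    rw [hRdef, LinearEquiv.symm_symm]
    exact h
  have hℓ₁off : ∀ k', k' ≠ n →
      IsRatTransport (family ℂ n d) k' hU (loopClassUniv n d ((α₀b.trans μ₀b).trans α₀b.symm)) (LinearEquiv.refl ℚ _) →
        IsRatTransport (family ℂ n d) k' hU (loopClassUniv n d ℓ₁b) (LinearEquiv.refl ℚ _) :=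
    fun k' _ hT => (hσ'T k' _ _ hℓ').2 hT
  -- one-node data for the meridian `μ₀b` from the supplier (even rider propagated from `γ`)
  have hs₀ : pointForm ℂ n d (P y₀) = F + (ρ₀ : ℂ) • g := by
    rw [hP, hy₀, hFdef]; simp only [Prod.fst_add, Prod.snd_add, add_zero, add_smul]; abel
  have hμ₀circ : IsPencilCircle n d F g ρ₀ μ₀b := by
    intro θ
    rw [hμ₀b, Path.map_coe, Function.comp_apply, hP, hμ₀ θ, hFdef]
    simp only [Prod.fst_add, Prod.snd_add, add_zero, add_smul]; abel
  have hrider₀ : Even n → ∀ T : bettiCohomology (fiberOver (family ℂ n d) (P y₀)) n ≃ₗ[ℚ]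
      bettiCohomology (fiberOver (family ℂ n d) (P y₀)) n,
      IsRatTransport (family ℂ n d) n hU (loopClassUniv n d μ₀b) T → T ≠ LinearEquiv.refl ℚ _ := by
    intro hev T hT hT1
    subst hT1
    -- transport along `ℓ₀ = α₀·μ₀·α₀⁻¹` is then the identity
    obtain ⟨K, hK⟩ := exists_isRatTransport_family hd n hU
      (Path.Homotopic.Quotient.mk (α₀b.map (toUniv n d).continuous) :
        Path.Homotopic.Quotient (toUniv n d (P x)) (toUniv n d (P y₀)))
    have hℓ₀T : IsRatTransport (family ℂ n d) n hU (loopClassUniv n d ((α₀b.trans μ₀b).trans α₀b.symm))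
        (K.trans ((LinearEquiv.refl ℚ _).trans K.symm)) :=
      isRatTransport_conj_of_loopClassUniv_eq hU (loopClassUniv_trans_trans_symm α₀b μ₀b) hK hT
    have hℓ₀T' : IsRatTransport (family ℂ n d) n hU (loopClassUniv n d ((α₀b.trans μ₀b).trans α₀b.symm))
        (LinearEquiv.refl ℚ _) := by
      convert hℓ₀T using 1; ext v; exact (K.symm_apply_apply v).symm
    have hℓ₁T' : IsRatTransport (family ℂ n d) n hU (loopClassUniv n d ℓ₁b) (LinearEquiv.refl ℚ _) := by
      convert hℓ₁T _ hℓ₀T' using 1; ext v; exact (R.apply_symm_apply v).symm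
    have hγT : IsRatTransport (family ℂ n d) n hU (loopClassUniv n d γ) (LinearEquiv.refl ℚ _) := by
      rw [hγ₁]
      convert hℓ₀T'.trans (family ℂ n d) n hU hℓ₁T' using 1; ext v; rfl
    exact hrider hev _ hγT rfl
  obtain ⟨δ₀, c₀, hμ₀data⟩ := hPL₀ hU ρ₀ hρ₀pos hρ₀ε (P y₀) hs₀ μ₀b hμ₀circ hrider₀
  -- the core
  obtain ⟨δ, c, hdata, -⟩ := exists_isPicardLefschetzData_two_of_meridian (γ := γ) (ℓ₁ := ℓ₁b) α₀b hμ₀data R hRiso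
    hℓ₁T hℓ₁off hγ₁ hcomm hrider
  refine ⟨![δ, R δ], c, hdata, fun σ'' hσ'' => Or.inl ?_⟩
  simp only [Matrix.cons_val_zero, Matrix.cons_val_one]
  rw [hRdef, BettiUniverse.pullEquiv_symm_apply]
  exact congrFun (congrArg DFunLike.coe (pull_eq_of_fibrePoint_eq σ'' σ'.hom (fun y => by rw [hσ'', hσ'coord]) n)) δ



/-! ### §4 hPL₂exch from hPL₁, and the unconditional monomial instance -/

/-- **hPL₂exch from hPL₁**: the named fact `picardLefschetz_exchangedPair` (Picard–Lefschetz data for a two-nodal member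
whose nodes are exchanged by a diagonal symmetry of the pencil, with the exchange rule) FOLLOWS from the one-node
Picard–Lefschetz theorem `picardLefschetz_oneNode` (module docstring). The finite-order hypothesis on `a` is not used.
[cite: VoisinHodgeII2003, §3.2.1 Thm. 3.16, Cor. 3.17, Rem. 3.21 and §2.3.2]
[cite: ArnoldGuseinzadeVarchenko2012, Part I §1.3 and §2.1] [cite: Lamotke1981, §6] -/
theorem picardLefschetz_exchangedPair_of_oneNode (hPL : picardLefschetz_oneNode) : picardLefschetz_exchangedPair := by
  intro n d hn hd f₁ g hf₁ hg p hnod hgp a _ ha₁ hag h10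
  exact picardLefschetz_exchangedPair_of_supplier n d hn hd f₁ g hf₁ hg
    (fun F hF z hz hgz => hPL n d hn hd F g hF hg z hz hgz) p hnod hgp a ha₁ hag h10

/-- **hPL₂exch for monomial pencil directions, UNCONDITIONALLY**: for `g = a′ • xᵢ^d` the one-node supplier is prover-Bx's
theorem `NodalPencil.picardLefschetz_oneNode_monomial`, so the conclusion of `picardLefschetz_exchangedPair` holds for
every two-nodal `f₁` of degree `d` whose nodes (off `xᵢ = 0`) are exchanged by a diagonal `a` stabilising `f₁` and `g`.
[cite: VoisinHodgeII2003, §3.2.1 Thm. 3.16, Cor. 3.17, Rem. 3.21 and §2.3.2]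
[cite: ArnoldGuseinzadeVarchenko2012, Part I §1.3 and §2.1] [cite: Lamotke1981, §6] -/
theorem picardLefschetz_exchangedPair_monomial (n d : ℕ) (hn : 1 ≤ n) (hd : 1 ≤ d)
    (f₁ : MvPolynomial (Fin (n + 2)) ℂ) (hf₁ : f₁.IsHomogeneous d) (i : Fin (n + 2)) (a' : ℂ)
    (p : Fin 2 → Fin (n + 2) → ℂ) (hnod : IsNodalFormWithNodes f₁ p)
    (hgp : ∀ j, eval (p j) (a' • X i ^ d : MvPolynomial (Fin (n + 2)) ℂ) ≠ 0)
    (a : Fin (n + 2) → ℂˣ) (ha₁ : a ∈ diagonalStabilizer f₁)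
    (hag : a ∈ diagonalStabilizer (a' • X i ^ d : MvPolynomial (Fin (n + 2)) ℂ)) (h10 : ∃ t : ℂ, a • p 1 = t • p 0) :
    ∃ ε₀ : ℝ, 0 < ε₀ ∧
      (∀ c' : ℂ, c' ≠ 0 → ‖c'‖ < ε₀ →
        SmoothHypersurface.IsNonsingularForm ℂ (f₁ + c' • (a' • X i ^ d : MvPolynomial (Fin (n + 2)) ℂ))) ∧
      ∀ (hU : IsCohomologicallyLocallyTrivialOn (family ℂ n d) Set.univ) (ε : ℝ), 0 < ε → ε < ε₀ →
        ∀ (s' : ComplexPoints (base ℂ n d)),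
          pointForm ℂ n d s' = f₁ + (ε : ℂ) • (a' • X i ^ d : MvPolynomial (Fin (n + 2)) ℂ) →
          ∀ (γ : Path s' s'), IsPencilCircle n d f₁ (a' • X i ^ d) ε γ →
            (Even n → ∀ T : bettiCohomology (fiberOver (family ℂ n d) s') n ≃ₗ[ℚ]
                bettiCohomology (fiberOver (family ℂ n d) s') n,
              IsRatTransport (family ℂ n d) n hU (loopClassUniv n d γ) T → T ≠ LinearEquiv.refl ℚ _) →
            ∃ (δ : Fin 2 → bettiCohomology (fiberOver (family ℂ n d) s') n) (c : ℚ),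
              IsPicardLefschetzData n d 2 hn hd hU γ δ c ∧
                ∀ (σ' : fiberOver (family ℂ n d) s' ⟶ fiberOver (family ℂ n d) s'),
                  (∀ x : ComplexPoints (fiberOver (family ℂ n d) s'),
                      fibrePoint n d s' (AlgPoints.map σ' x) =
                        Projectivization.mk ℂ (a • (fibrePoint n d s' x).rep)
                          ((smul_ne_zero_iff_ne a).mpr (Projectivization.rep_nonzero _))) →
                  BettiUniverse.pull σ' n (δ 0) = δ 1 ∨ BettiUniverse.pull σ' n (δ 0) = -δ 1 :=
  picardLefschetz_exchangedPair_of_supplier n d hn hd f₁ (a' • X i ^ d) hf₁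
    ((homogeneousSubmodule (Fin (n + 2)) ℂ d).smul_mem a' (isHomogeneous_X_pow i d))
    (fun F hF z hz hgz => NodalPencil.picardLefschetz_oneNode_monomial n d hn hd F hF z hz i a' hgz)
    p hnod hgp a ha₁ hag h10

end Literature.AlgebraicGeometry.HodgeTheory

end
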